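import Summits.CriticalPhenomena.Ising3DConformalLimit.Theorems.LatticeSDPCertificatesWindowForcesU4ThetaBubble
import Summits.CriticalPhenomena.Ising3DConformalLimit.Theorems.LatticeSDPCertificatesWindowForcesU4BackboneCauchySchwarz
import Summits.CriticalPhenomena.Ising3DConformalLimit.Theorems.LatticeSDPCertificatesWindowForcesU4BackboneDensityDictionary
import Summits.CriticalPhenomena.Ising3DConformalLimit.Theorems.LatticeSDPCertificatesWindowForcesU4BackboneMomentComparison
import HarnessLib

/-!
# Crux `WindowForcesU4` (stmt-CriticalPhenomena-5505), line `backbone-thinning-window`: the registered stub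
# `stub_backbonePZ` — Paley–Zygmund AT THE SINGLE-CURRENT SCALE (glue of reshape r1, lead c3)

From the two-sided thinning bounds of the Aizenman backbone with exponent `θ` (hypotheses, in the
un-normalised current-sum form of the line's open stub `stub_backboneExponent`), an admissible window
`(ε, cW)` with room `θ < ε`, the four LANDED stubs of reshape r1 give: the backbones
`Γᵢ = vis (explore rk nᵢ …)` of two INDEPENDENT critical currents of `Λ_n` with sources `(0, 4Le₁)` and
`(2Le₁+3Le₂, 2Le₁-3Le₂)` share a vertex with `P^{ab} ⊗ P^{a'b'}`-probability `≥ c₀ > 0`, eventually in `L`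
and `n`:
* P0 `ThetaBubbleProof.stub_thetaBubble` (p172407): `Σ_{0≠w∈Λ_R} ‖w‖^{-2θ}G(w)² ≤ C_b R^{3-2θ}G(Re₁)²`;
* P3 `BackboneMomentComparisonProof.stub_backboneMomentComparison` (p173585): `c₀·ΣΣ g₁g₂ ≤ (Σ f₁f₂)²`,
  `Σ f₁f₂ > 0` on the counting region `Λ_L + 2Le₁` for any densities obeying the two-sided bounds;
* P2 `BackboneDensityDictionaryProof.stub_backboneDensityDictionary` (p172667): the current-sum hypotheses
  read as bounds on the `P^{ab}`-densities `fᵢ(u) = P[u ∈ Γᵢ]`, `gᵢ(u,v) = P[u,v ∈ Γᵢ]` (this needs the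
  sup-norm geometry of the region against the four sources, §1);
* P1 `BackboneCauchySchwarzProof.stub_backboneCauchySchwarz` (p172466): `(Σ f₁f₂)² ≤ P[Γ₁∩Γ₂≠∅]·ΣΣ g₁g₂`.
Hence `c₀ ≤ P[Γ₁ ∩ Γ₂ ≠ ∅]`. Pure glue; no definition, no named fact.
Reference: M. Aizenman, H. Duminil-Copin, Ann. of Math. 194 (2021) = arXiv:1912.07973, §4.2 Lemma 4.4.
-/

noncomputable section

namespace Summit.CriticalPhenomena.Ising3DConformalLimit.LatticeSDPCertificatesWindowForcesU4.BackbonePZProof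

open Filter Topology MeasureTheory
open scoped symmDiff ENNReal
open Literature.Probability.LatticeModels Literature.Probability.Percolation
open Summit.CriticalPhenomena.Ising3DConformalLimit.Cruxes.IsingEuclidUpgradeR4NonGaussian.FreeCovarianceDeltaDichotomy
  (boxG threePointRatio twoStep)

/-! ## §0. The landed stubs P1, P2 re-read with this file's instances -/

/-- The landed Cauchy–Schwarz stub, re-read with this file's `Decidable` instances (it is stated under
`open scoped Classical` in its own file; `convert` bridges the instance terms). [cite: AizenmanDuminilCopinAnnals2021, §4.2, proof of Lemma 4.4] -/
private theorem cauchySchwarz :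
    ∀ (n : ℕ) (rk : (freeBoxGraph 3 n).edgeFinset → ℕ) (a b a' b' : BoxVertex 3 n) (A : Finset (BoxVertex 3 n)),
      (∑ u ∈ A, (currentLaw (freeBoxGraph 3 n) (criticalBeta 3) ({a} ∆ {b})).real {m | u ∈ (Current.explore rk m {b} a).vis} *
          (currentLaw (freeBoxGraph 3 n) (criticalBeta 3) ({a'} ∆ {b'})).real {m | u ∈ (Current.explore rk m {b'} a').vis}) ^ 2 ≤
        (doubleCurrentMeasure (freeBoxGraph 3 n) (criticalBeta 3) ({a} ∆ {b}) ({a'} ∆ {b'})).real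
            {p | ((Current.explore rk p.1 {b} a).vis ∩ (Current.explore rk p.2 {b'} a').vis).Nonempty} *
          ∑ u ∈ A, ∑ v ∈ A,
            (currentLaw (freeBoxGraph 3 n) (criticalBeta 3) ({a} ∆ {b})).real
                {m | u ∈ (Current.explore rk m {b} a).vis ∧ v ∈ (Current.explore rk m {b} a).vis} *
              (currentLaw (freeBoxGraph 3 n) (criticalBeta 3) ({a'} ∆ {b'})).real
                {m | u ∈ (Current.explore rk m {b'} a').vis ∧ v ∈ (Current.explore rk m {b'} a').vis} := by
  intro n rk a b a' b' A
  convert Summit.CriticalPhenomena.Ising3DConformalLimit.LatticeSDPCertificatesWindowForcesU4.BackboneCauchySchwarzProof.stub_backboneCauchySchwarz n rk a b a' b' A using 0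

/-- The landed density dictionary, re-read with this file's instances. [folklore] -/
private theorem dictionary :
    ∀ (n : ℕ) (rk : (freeBoxGraph 3 n).edgeFinset → ℕ) (a b u v : BoxVertex 3 n) (κ : ℝ), 0 ≤ κ →
      (a : Site 3) ∈ box 3 n → (b : Site 3) ∈ box 3 n → (u : Site 3) ∈ box 3 n → (v : Site 3) ∈ box 3 n → a ≠ b →
      (ENNReal.ofReal κ *
            (ecurrentSum (fun _ : (freeBoxGraph 3 n).edgeFinset => criticalBeta 3) ({a} ∆ {u}) *
              ecurrentSum (fun _ : (freeBoxGraph 3 n).edgeFinset => criticalBeta 3) ({u} ∆ {b})) ≤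
          (∑' m : Current (freeBoxGraph 3 n),
              (if m.sources = {a} ∆ {b} then m.eweight (fun _ => criticalBeta 3) else 0) *
                (if u ∈ (Current.explore rk m {b} a).vis then 1 else 0)) *
            ecurrentSum (fun _ : (freeBoxGraph 3 n).edgeFinset => criticalBeta 3) ∅ →
        κ * threePointRatio n (a : Site 3) (b : Site 3) (u : Site 3) ≤
          (currentLaw (freeBoxGraph 3 n) (criticalBeta 3) ({a} ∆ {b})).real {m | u ∈ (Current.explore rk m {b} a).vis}) ∧
      ((∑' m : Current (freeBoxGraph 3 n),
            (if m.sources = {a} ∆ {b} then m.eweight (fun _ => criticalBeta 3) else 0) *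
              (if u ∈ (Current.explore rk m {b} a).vis ∧ v ∈ (Current.explore rk m {b} a).vis then 1 else 0)) *
            ecurrentSum (fun _ : (freeBoxGraph 3 n).edgeFinset => criticalBeta 3) ∅ * ecurrentSum (fun _ : (freeBoxGraph 3 n).edgeFinset => criticalBeta 3) ∅ ≤
          ENNReal.ofReal κ *
            (ecurrentSum (fun _ : (freeBoxGraph 3 n).edgeFinset => criticalBeta 3) ({a} ∆ {u}) * ecurrentSum (fun _ : (freeBoxGraph 3 n).edgeFinset => criticalBeta 3) ({u} ∆ {v}) * ecurrentSum (fun _ : (freeBoxGraph 3 n).edgeFinset => criticalBeta 3) ({v} ∆ {b}) +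
              ecurrentSum (fun _ : (freeBoxGraph 3 n).edgeFinset => criticalBeta 3) ({a} ∆ {v}) * ecurrentSum (fun _ : (freeBoxGraph 3 n).edgeFinset => criticalBeta 3) ({v} ∆ {u}) * ecurrentSum (fun _ : (freeBoxGraph 3 n).edgeFinset => criticalBeta 3) ({u} ∆ {b})) →
        (currentLaw (freeBoxGraph 3 n) (criticalBeta 3) ({a} ∆ {b})).real
            {m | u ∈ (Current.explore rk m {b} a).vis ∧ v ∈ (Current.explore rk m {b} a).vis} ≤
          κ * twoStep n (a : Site 3) (b : Site 3) (u : Site 3) (v : Site 3) / boxG n (a : Site 3) (b : Site 3)) := by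
  have h := Summit.CriticalPhenomena.Ising3DConformalLimit.LatticeSDPCertificatesWindowForcesU4.BackboneDensityDictionaryProof.stub_backboneDensityDictionary
  convert h using 0


/-! ## §1. The canonical shape and the sup-norm geometry of the counting region -/


/-- Coordinates of the canonical shape. [folklore] -/
private theorem Y_apply (Y : Fin 4 → Site 3)
    (hY : Y = (![0, (4 : ℤ) • Pi.single 0 1, (2 : ℤ) • Pi.single 0 1 + (3 : ℤ) • Pi.single 1 1, (2 : ℤ) • Pi.single 0 1 - (3 : ℤ) • Pi.single 1 1] : Fin 4 → Site 3)) (L : ℕ) :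
    ((L : ℤ) • Y 0 = 0) ∧
    (∀ i, ((L : ℤ) • Y 1) i = if i = 0 then 4 * (L : ℤ) else 0) ∧
    (∀ i, ((L : ℤ) • Y 2) i = if i = 0 then 2 * (L : ℤ) else if i = 1 then 3 * (L : ℤ) else 0) ∧
    (∀ i, ((L : ℤ) • Y 3) i = if i = 0 then 2 * (L : ℤ) else if i = 1 then -(3 * (L : ℤ)) else 0) := by
  subst hY
  refine ⟨?_, ?_, ?_, ?_⟩
  · simp
  all_goals intro i; fin_cases i <;> simp <;> ring

/-- Sup-norm bounds from coordinate bounds. [folklore] -/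
private theorem norm_le_of_coord {x : Site 3} {M : ℕ} (h : ∀ i, (x i).natAbs ≤ M) : ‖x‖ ≤ (M : ℝ) := by
  rw [Site.norm_eq_supNorm]
  exact_mod_cast Site.supNorm_le_iff.2 h

/-- Sup-norm lower bound from one coordinate. [folklore] -/
private theorem le_norm_of_coord {x : Site 3} {M : ℕ} (i : Fin 3) (h : M ≤ (x i).natAbs) : (M : ℝ) ≤ ‖x‖ := by
  rw [Site.norm_eq_supNorm]
  exact_mod_cast h.trans (Site.natAbs_le_supNorm x i)

/-- Geometry of the counting region `Λ_L + 2Le₁` against the four canonical sources: all eight distances lie in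
`[L, 8L]`, and the region lies in `Λ_{3L}`. [folklore] -/
private theorem region_geometry (Y : Fin 4 → Site 3)
    (hY : Y = (![0, (4 : ℤ) • Pi.single 0 1, (2 : ℤ) • Pi.single 0 1 + (3 : ℤ) • Pi.single 1 1, (2 : ℤ) • Pi.single 0 1 - (3 : ℤ) • Pi.single 1 1] : Fin 4 → Site 3)) {L : ℕ} {u : Site 3}
    (hu : u - (2 * (L : ℤ)) • (Pi.single 0 1 : Site 3) ∈ box 3 L) :
    ((L : ℝ) ≤ ‖u - (L : ℤ) • Y 0‖ ∧ ‖u - (L : ℤ) • Y 0‖ ≤ 8 * (L : ℝ)) ∧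
    ((L : ℝ) ≤ ‖u - (L : ℤ) • Y 1‖ ∧ ‖u - (L : ℤ) • Y 1‖ ≤ 8 * (L : ℝ)) ∧
    ((L : ℝ) ≤ ‖u - (L : ℤ) • Y 2‖ ∧ ‖u - (L : ℤ) • Y 2‖ ≤ 8 * (L : ℝ)) ∧
    ((L : ℝ) ≤ ‖u - (L : ℤ) • Y 3‖ ∧ ‖u - (L : ℤ) • Y 3‖ ≤ 8 * (L : ℝ)) ∧
    u ∈ box 3 (3 * L) := by
  subst hY
  obtain ⟨h0, h1, h2, h3⟩ := Y_apply _ rfl L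
  rw [mem_box] at hu
  have hu0 := hu 0
  have hu1 := hu 1
  have hu2 := hu 2
  simp only [Pi.sub_apply, Pi.smul_apply, Pi.single_apply, smul_eq_mul] at hu0 hu1 hu2
  norm_num at hu0 hu1 hu2
  have e8 : (8 : ℝ) * L = ((8 * L : ℕ) : ℝ) := by push_cast; ring
  refine ⟨⟨?_, ?_⟩, ⟨?_, ?_⟩, ⟨?_, ?_⟩, ⟨?_, ?_⟩, ?_⟩
  · refine le_norm_of_coord 0 ?_; rw [h0, sub_zero]; omega
  · rw [e8, h0, sub_zero]; refine norm_le_of_coord fun j => ?_; fin_cases j <;> simp <;> omega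
  · refine le_norm_of_coord 0 ?_; rw [Pi.sub_apply, h1 0]; simp; omega
  · rw [e8]; refine norm_le_of_coord fun j => ?_; rw [Pi.sub_apply, h1 j]; fin_cases j <;> simp <;> omega
  · refine le_norm_of_coord 1 ?_; rw [Pi.sub_apply, h2 1]; simp; omega
  · rw [e8]; refine norm_le_of_coord fun j => ?_; rw [Pi.sub_apply, h2 j]; fin_cases j <;> simp <;> omega
  · refine le_norm_of_coord 1 ?_; rw [Pi.sub_apply, h3 1]; simp; omega
  · rw [e8]; refine norm_le_of_coord fun j => ?_; rw [Pi.sub_apply, h3 j]; fin_cases j <;> simp <;> omega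
  · rw [mem_box]; intro j; fin_cases j <;> simp <;> omega

/-- Geometry of the four canonical sources: norms `≤ 8L`, pair distances in `[L, 8L]`, all in `Λ_{4L}`, and the
two sources of each pair are distinct once `L ≥ 1`. [folklore] -/
private theorem source_geometry (Y : Fin 4 → Site 3)
    (hY : Y = (![0, (4 : ℤ) • Pi.single 0 1, (2 : ℤ) • Pi.single 0 1 + (3 : ℤ) • Pi.single 1 1, (2 : ℤ) • Pi.single 0 1 - (3 : ℤ) • Pi.single 1 1] : Fin 4 → Site 3)) {L : ℕ} (hL : 1 ≤ L) :
    (‖(L : ℤ) • Y 0‖ ≤ 8 * (L : ℝ) ∧ ‖(L : ℤ) • Y 1‖ ≤ 8 * (L : ℝ) ∧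
      ‖(L : ℤ) • Y 2‖ ≤ 8 * (L : ℝ) ∧ ‖(L : ℤ) • Y 3‖ ≤ 8 * (L : ℝ)) ∧
    ((L : ℝ) ≤ ‖(L : ℤ) • Y 0 - (L : ℤ) • Y 1‖ ∧ ‖(L : ℤ) • Y 0 - (L : ℤ) • Y 1‖ ≤ 8 * (L : ℝ)) ∧
    ((L : ℝ) ≤ ‖(L : ℤ) • Y 2 - (L : ℤ) • Y 3‖ ∧ ‖(L : ℤ) • Y 2 - (L : ℤ) • Y 3‖ ≤ 8 * (L : ℝ)) ∧
    ((L : ℤ) • Y 0 ∈ box 3 (4 * L) ∧ (L : ℤ) • Y 1 ∈ box 3 (4 * L) ∧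
      (L : ℤ) • Y 2 ∈ box 3 (4 * L) ∧ (L : ℤ) • Y 3 ∈ box 3 (4 * L)) ∧
    (L : ℤ) • Y 0 ≠ (L : ℤ) • Y 1 ∧ (L : ℤ) • Y 2 ≠ (L : ℤ) • Y 3 := by
  subst hY
  obtain ⟨h0, h1, h2, h3⟩ := Y_apply _ rfl L
  have e8 : (8 : ℝ) * L = ((8 * L : ℕ) : ℝ) := by push_cast; ring
  refine ⟨⟨?_, ?_, ?_, ?_⟩, ⟨?_, ?_⟩, ⟨?_, ?_⟩, ⟨?_, ?_, ?_, ?_⟩, ?_, ?_⟩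
  · rw [h0, norm_zero]; positivity
  · rw [e8]; refine norm_le_of_coord fun j => ?_; rw [h1 j]; fin_cases j <;> simp
    omega
  · rw [e8]; refine norm_le_of_coord fun j => ?_; rw [h2 j]; fin_cases j <;> simp <;> omega
  · rw [e8]; refine norm_le_of_coord fun j => ?_; rw [h3 j]; fin_cases j <;> simp <;> omega
  · refine le_norm_of_coord 0 ?_; rw [Pi.sub_apply, h0, h1 0]; simp; omega
  · rw [e8]; refine norm_le_of_coord fun j => ?_; rw [Pi.sub_apply, h0, h1 j]; fin_cases j <;> simp
    omega
  · refine le_norm_of_coord 1 ?_; rw [Pi.sub_apply, h2 1, h3 1]; simp; omega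
  · rw [e8]; refine norm_le_of_coord fun j => ?_; rw [Pi.sub_apply, h2 j, h3 j]; fin_cases j <;> simp
    omega
  · rw [h0, mem_box]; intro j; simp
  · rw [mem_box]; intro j; rw [h1 j]; fin_cases j <;> simp
  · rw [mem_box]; intro j; rw [h2 j]; fin_cases j <;> simp <;> omega
  · rw [mem_box]; intro j; rw [h3 j]; fin_cases j <;> simp <;> omega
  · intro h; have := congr_fun h 0; rw [h0, Pi.zero_apply, h1 0] at this; simp at this; omega
  · intro h; have := congr_fun h 1; rw [h2 1, h3 1] at this; simp at this; omega

/-- **Registered stub `stub_backbonePZ` of line `backbone-thinning-window` (PALEY–ZYGMUND AT THE SINGLE-CURRENT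
SCALE), proved as the glue of the four landed stubs P0–P3 of reshape r1**: θ-bubble (P0) + moment comparison on the counting region (P3) applied to
the backbone densities of the two independent currents, whose bounds are the hypotheses read through the
dictionary (P2), and Cauchy–Schwarz (P1). [cite: AizenmanDuminilCopinAnnals2021, §4.2 Lemma 4.4] -/
theorem stub_backbonePZ :
    ∀ θ c C ε cW : ℝ, 0 ≤ θ → 0 < c → 0 < C → 0 < ε → 0 < cW → θ < ε →
      (∀ m n : ℕ, 1 ≤ m → m ≤ n → cW * ((n : ℝ) / m) ^ (-((3:ℝ) / 2 - ε)) * criticalTwoPoint 3 (Pi.single 0 (m : ℤ)) ≤ criticalTwoPoint 3 (Pi.single 0 (n : ℤ))) →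
      (∀ᶠ L : ℕ in atTop, ∀ᶠ n : ℕ in atTop,
        ∃ rk : (freeBoxGraph 3 n).edgeFinset → ℕ, Function.Injective rk ∧
          (∀ a b u : BoxVertex 3 n, ‖(a : Site 3)‖ ≤ 8 * (L : ℝ) → ‖(b : Site 3)‖ ≤ 8 * (L : ℝ) →
            (L : ℝ) ≤ ‖(a : Site 3) - (b : Site 3)‖ → ‖(a : Site 3) - (b : Site 3)‖ ≤ 8 * (L : ℝ) →
            (L : ℝ) ≤ ‖(u : Site 3) - (a : Site 3)‖ → ‖(u : Site 3) - (a : Site 3)‖ ≤ 8 * (L : ℝ) →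
            (L : ℝ) ≤ ‖(u : Site 3) - (b : Site 3)‖ → ‖(u : Site 3) - (b : Site 3)‖ ≤ 8 * (L : ℝ) →
            ENNReal.ofReal (c * (L : ℝ) ^ (-θ)) *
                (ecurrentSum (fun _ : (freeBoxGraph 3 n).edgeFinset => criticalBeta 3) ({a} ∆ {u}) *
                  ecurrentSum (fun _ : (freeBoxGraph 3 n).edgeFinset => criticalBeta 3) ({u} ∆ {b})) ≤
              (∑' m : Current (freeBoxGraph 3 n),
                  (if m.sources = {a} ∆ {b} then m.eweight (fun _ => criticalBeta 3) else 0) *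
                    (if u ∈ (Current.explore rk m {b} a).vis then 1 else 0)) *
                ecurrentSum (fun _ : (freeBoxGraph 3 n).edgeFinset => criticalBeta 3) ∅) ∧
          (∀ a b u v : BoxVertex 3 n, u ≠ v → ‖(a : Site 3)‖ ≤ 8 * (L : ℝ) → ‖(b : Site 3)‖ ≤ 8 * (L : ℝ) →
            (L : ℝ) ≤ ‖(a : Site 3) - (b : Site 3)‖ → ‖(a : Site 3) - (b : Site 3)‖ ≤ 8 * (L : ℝ) →
            (L : ℝ) ≤ ‖(u : Site 3) - (a : Site 3)‖ → ‖(u : Site 3) - (a : Site 3)‖ ≤ 8 * (L : ℝ) →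
            (L : ℝ) ≤ ‖(u : Site 3) - (b : Site 3)‖ → ‖(u : Site 3) - (b : Site 3)‖ ≤ 8 * (L : ℝ) →
            (L : ℝ) ≤ ‖(v : Site 3) - (a : Site 3)‖ → ‖(v : Site 3) - (a : Site 3)‖ ≤ 8 * (L : ℝ) →
            (L : ℝ) ≤ ‖(v : Site 3) - (b : Site 3)‖ → ‖(v : Site 3) - (b : Site 3)‖ ≤ 8 * (L : ℝ) →
            (∑' m : Current (freeBoxGraph 3 n),
                (if m.sources = {a} ∆ {b} then m.eweight (fun _ => criticalBeta 3) else 0) *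
                  (if u ∈ (Current.explore rk m {b} a).vis ∧ v ∈ (Current.explore rk m {b} a).vis then 1 else 0)) *
                ecurrentSum (fun _ : (freeBoxGraph 3 n).edgeFinset => criticalBeta 3) ∅ * ecurrentSum (fun _ : (freeBoxGraph 3 n).edgeFinset => criticalBeta 3) ∅ ≤
              ENNReal.ofReal (C * (L : ℝ) ^ (-θ) * ‖(u : Site 3) - (v : Site 3)‖ ^ (-θ)) *
                (ecurrentSum (fun _ : (freeBoxGraph 3 n).edgeFinset => criticalBeta 3) ({a} ∆ {u}) * ecurrentSum (fun _ : (freeBoxGraph 3 n).edgeFinset => criticalBeta 3) ({u} ∆ {v}) * ecurrentSum (fun _ : (freeBoxGraph 3 n).edgeFinset => criticalBeta 3) ({v} ∆ {b}) +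
                  ecurrentSum (fun _ : (freeBoxGraph 3 n).edgeFinset => criticalBeta 3) ({a} ∆ {v}) * ecurrentSum (fun _ : (freeBoxGraph 3 n).edgeFinset => criticalBeta 3) ({v} ∆ {u}) * ecurrentSum (fun _ : (freeBoxGraph 3 n).edgeFinset => criticalBeta 3) ({u} ∆ {b})))) →
      ∃ c₀ : ℝ, 0 < c₀ ∧ ∀ᶠ L : ℕ in atTop, ∀ᶠ n : ℕ in atTop,
        ∃ rk : (freeBoxGraph 3 n).edgeFinset → ℕ, Function.Injective rk ∧
          ∃ a b a' b' : BoxVertex 3 n,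
            (a : Site 3) = (L : ℤ) • (![0, (4 : ℤ) • Pi.single 0 1, (2 : ℤ) • Pi.single 0 1 + (3 : ℤ) • Pi.single 1 1, (2 : ℤ) • Pi.single 0 1 - (3 : ℤ) • Pi.single 1 1] : Fin 4 → Site 3) 0 ∧
            (b : Site 3) = (L : ℤ) • (![0, (4 : ℤ) • Pi.single 0 1, (2 : ℤ) • Pi.single 0 1 + (3 : ℤ) • Pi.single 1 1, (2 : ℤ) • Pi.single 0 1 - (3 : ℤ) • Pi.single 1 1] : Fin 4 → Site 3) 1 ∧
            (a' : Site 3) = (L : ℤ) • (![0, (4 : ℤ) • Pi.single 0 1, (2 : ℤ) • Pi.single 0 1 + (3 : ℤ) • Pi.single 1 1, (2 : ℤ) • Pi.single 0 1 - (3 : ℤ) • Pi.single 1 1] : Fin 4 → Site 3) 2 ∧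
            (b' : Site 3) = (L : ℤ) • (![0, (4 : ℤ) • Pi.single 0 1, (2 : ℤ) • Pi.single 0 1 + (3 : ℤ) • Pi.single 1 1, (2 : ℤ) • Pi.single 0 1 - (3 : ℤ) • Pi.single 1 1] : Fin 4 → Site 3) 3 ∧
            c₀ ≤ (doubleCurrentMeasure (freeBoxGraph 3 n) (criticalBeta 3) ({a} ∆ {b}) ({a'} ∆ {b'})).real
              {p | ((Current.explore rk p.1 {b} a).vis ∩ (Current.explore rk p.2 {b'} a').vis).Nonempty} := by
  intro θ c C ε cW hθ hc hC hε hcW hθε hW hT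
  obtain ⟨Cb, hCb, hB⟩ := Summit.CriticalPhenomena.Ising3DConformalLimit.LatticeSDPCertificatesWindowForcesU4.ThetaBubbleProof.stub_thetaBubble θ ε cW hθ hθε hcW hW
  obtain ⟨c₀, hc₀, hcmp⟩ :=
    Summit.CriticalPhenomena.Ising3DConformalLimit.LatticeSDPCertificatesWindowForcesU4.BackboneMomentComparisonProof.stub_backboneMomentComparison θ c C ε cW Cb hθ hc hC hε hcW hθε hCb hW hB
  refine ⟨c₀, hc₀, ?_⟩
  filter_upwards [hT, hcmp, eventually_ge_atTop 1] with L hTL hcmpL hL1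
  obtain ⟨⟨hYn0, hYn1, hYn2, hYn3⟩, hY01, hY23, ⟨hYb0, hYb1, hYb2, hYb3⟩, hne01, hne23⟩ := source_geometry _ rfl hL1
  filter_upwards [hTL, hcmpL, eventually_ge_atTop (4 * L)] with n hTn hcmpn hn4
  obtain ⟨rk, hrk, h1, h2⟩ := hTn
  have hbox4 : box 3 (4 * L) ⊆ box 3 n := box_mono 3 hn4
  have hbox3 : box 3 (3 * L) ⊆ box 3 n := box_mono 3 (by omega)
  -- the four sources as box vertices
  set a : BoxVertex 3 n := ⟨(L : ℤ) • (![0, (4 : ℤ) • Pi.single 0 1, (2 : ℤ) • Pi.single 0 1 + (3 : ℤ) • Pi.single 1 1, (2 : ℤ) • Pi.single 0 1 - (3 : ℤ) • Pi.single 1 1] : Fin 4 → Site 3) 0, box_subset_box_succ 3 n (hbox4 hYb0)⟩ with ha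
  set b : BoxVertex 3 n := ⟨(L : ℤ) • (![0, (4 : ℤ) • Pi.single 0 1, (2 : ℤ) • Pi.single 0 1 + (3 : ℤ) • Pi.single 1 1, (2 : ℤ) • Pi.single 0 1 - (3 : ℤ) • Pi.single 1 1] : Fin 4 → Site 3) 1, box_subset_box_succ 3 n (hbox4 hYb1)⟩ with hb
  set a' : BoxVertex 3 n := ⟨(L : ℤ) • (![0, (4 : ℤ) • Pi.single 0 1, (2 : ℤ) • Pi.single 0 1 + (3 : ℤ) • Pi.single 1 1, (2 : ℤ) • Pi.single 0 1 - (3 : ℤ) • Pi.single 1 1] : Fin 4 → Site 3) 2, box_subset_box_succ 3 n (hbox4 hYb2)⟩ with ha'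
  set b' : BoxVertex 3 n := ⟨(L : ℤ) • (![0, (4 : ℤ) • Pi.single 0 1, (2 : ℤ) • Pi.single 0 1 + (3 : ℤ) • Pi.single 1 1, (2 : ℤ) • Pi.single 0 1 - (3 : ℤ) • Pi.single 1 1] : Fin 4 → Site 3) 3, box_subset_box_succ 3 n (hbox4 hYb3)⟩ with hb'
  have hab : a ≠ b := fun h => hne01 (congrArg Subtype.val h)
  have hab' : a' ≠ b' := fun h => hne23 (congrArg Subtype.val h)
  refine ⟨rk, hrk, a, b, a', b', rfl, rfl, rfl, rfl, ?_⟩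
  -- the backbone densities of the two independent currents
  set P₁ := currentLaw (freeBoxGraph 3 n) (criticalBeta 3) ({a} ∆ {b}) with hP₁
  set P₂ := currentLaw (freeBoxGraph 3 n) (criticalBeta 3) ({a'} ∆ {b'}) with hP₂
  set f₁ : BoxVertex 3 n → ℝ := fun u => P₁.real {m | u ∈ (Current.explore rk m {b} a).vis} with hf₁
  set f₂ : BoxVertex 3 n → ℝ := fun u => P₂.real {m | u ∈ (Current.explore rk m {b'} a').vis} with hf₂
  set g₁ : BoxVertex 3 n → BoxVertex 3 n → ℝ :=
    fun u v => P₁.real {m | u ∈ (Current.explore rk m {b} a).vis ∧ v ∈ (Current.explore rk m {b} a).vis} with hg₁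
  set g₂ : BoxVertex 3 n → BoxVertex 3 n → ℝ :=
    fun u v => P₂.real {m | u ∈ (Current.explore rk m {b'} a').vis ∧ v ∈ (Current.explore rk m {b'} a').vis} with hg₂
  set A : Finset (BoxVertex 3 n) :=
    Finset.univ.filter (fun u : BoxVertex 3 n => ((u : Site 3) - (2 * (L : ℤ)) • (Pi.single 0 1 : Site 3)) ∈ box 3 L) with hA
  -- P1: Cauchy–Schwarz
  have hCS := cauchySchwarz n rk a b a' b' A
  -- the bounds on the densities, through the dictionary P2
  have hdiag : ∀ u : BoxVertex 3 n, g₁ u u = f₁ u ∧ g₂ u u = f₂ u := fun u => by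
    simp only [hg₁, hg₂, hf₁, hf₂, and_self]
  have hone : ∀ u : BoxVertex 3 n, ((u : Site 3) - (2 * (L : ℤ)) • (Pi.single 0 1 : Site 3)) ∈ box 3 L →
      c * (L : ℝ) ^ (-θ) * threePointRatio n (a : Site 3) (b : Site 3) (u : Site 3) ≤ f₁ u ∧
      c * (L : ℝ) ^ (-θ) * threePointRatio n (a' : Site 3) (b' : Site 3) (u : Site 3) ≤ f₂ u ∧
      0 ≤ g₁ u u ∧ g₁ u u ≤ f₁ u ∧ 0 ≤ g₂ u u ∧ g₂ u u ≤ f₂ u := by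
    intro u hu
    obtain ⟨⟨hu0, hu0'⟩, ⟨hu1, hu1'⟩, ⟨hu2, hu2'⟩, ⟨hu3, hu3'⟩, hubox⟩ := region_geometry _ rfl hu
    have hubox' : (u : Site 3) ∈ box 3 n := hbox3 hubox
    have hκ : 0 ≤ c * (L : ℝ) ^ (-θ) := mul_nonneg hc.le (Real.rpow_nonneg (Nat.cast_nonneg L) _)
    have hd₁ := (dictionary n rk a b u u _ hκ (hbox4 hYb0) (hbox4 hYb1) hubox' hubox' hab).1
      (h1 a b u hYn0 hYn1 hY01.1 hY01.2 hu0 hu0' hu1 hu1')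
    have hd₂ := (dictionary n rk a' b' u u _ hκ (hbox4 hYb2) (hbox4 hYb3) hubox' hubox' hab').1
      (h1 a' b' u hYn2 hYn3 hY23.1 hY23.2 hu2 hu2' hu3 hu3')
    refine ⟨hd₁, hd₂, ?_, ?_, ?_, ?_⟩
    · exact measureReal_nonneg
    · exact (hdiag u).1.le
    · exact measureReal_nonneg
    · exact (hdiag u).2.le
  have htwo : ∀ u v : BoxVertex 3 n, u ≠ v →
      ((u : Site 3) - (2 * (L : ℤ)) • (Pi.single 0 1 : Site 3)) ∈ box 3 L →
      ((v : Site 3) - (2 * (L : ℤ)) • (Pi.single 0 1 : Site 3)) ∈ box 3 L →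
      0 ≤ g₁ u v ∧
      g₁ u v ≤ C * (L : ℝ) ^ (-θ) * ‖(u : Site 3) - (v : Site 3)‖ ^ (-θ) *
        twoStep n (a : Site 3) (b : Site 3) (u : Site 3) (v : Site 3) / boxG n (a : Site 3) (b : Site 3) ∧
      0 ≤ g₂ u v ∧
      g₂ u v ≤ C * (L : ℝ) ^ (-θ) * ‖(u : Site 3) - (v : Site 3)‖ ^ (-θ) *
        twoStep n (a' : Site 3) (b' : Site 3) (u : Site 3) (v : Site 3) / boxG n (a' : Site 3) (b' : Site 3) := by
    intro u v huv hu hv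
    obtain ⟨⟨hu0, hu0'⟩, ⟨hu1, hu1'⟩, ⟨hu2, hu2'⟩, ⟨hu3, hu3'⟩, hubox⟩ := region_geometry _ rfl hu
    obtain ⟨⟨hv0, hv0'⟩, ⟨hv1, hv1'⟩, ⟨hv2, hv2'⟩, ⟨hv3, hv3'⟩, hvbox⟩ := region_geometry _ rfl hv
    have huox' : (u : Site 3) ∈ box 3 n := hbox3 hubox
    have hvox' : (v : Site 3) ∈ box 3 n := hbox3 hvbox
    have hκ : 0 ≤ C * (L : ℝ) ^ (-θ) * ‖(u : Site 3) - (v : Site 3)‖ ^ (-θ) :=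
      mul_nonneg (mul_nonneg hC.le (Real.rpow_nonneg (Nat.cast_nonneg L) _)) (Real.rpow_nonneg (norm_nonneg _) _)
    have hd₁ := (dictionary n rk a b u v _ hκ (hbox4 hYb0) (hbox4 hYb1) huox' hvox' hab).2
      (h2 a b u v huv hYn0 hYn1 hY01.1 hY01.2 hu0 hu0' hu1 hu1' hv0 hv0' hv1 hv1')
    have hd₂ := (dictionary n rk a' b' u v _ hκ (hbox4 hYb2) (hbox4 hYb3) huox' hvox' hab').2
      (h2 a' b' u v huv hYn2 hYn3 hY23.1 hY23.2 hu2 hu2' hu3 hu3' hv2 hv2' hv3 hv3')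
    exact ⟨measureReal_nonneg, hd₁, measureReal_nonneg, hd₂⟩
  -- P3: moment comparison
  obtain ⟨hcmp', hpos⟩ := hcmpn a b a' b' rfl rfl rfl rfl f₁ f₂ g₁ g₂ hone htwo
  -- conclusion: c₀ ≤ P[Γ₁ ∩ Γ₂ ≠ ∅]
  have hG : 0 ≤ ∑ u ∈ A, ∑ v ∈ A, g₁ u v * g₂ u v :=
    Finset.sum_nonneg fun u _ => Finset.sum_nonneg fun v _ => mul_nonneg measureReal_nonneg measureReal_nonneg
  by_contra hlt
  push Not at hlt
  rcases hG.eq_or_lt with h0 | hGpos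
  · rw [← h0, mul_zero] at hCS
    have : ∑ u ∈ A, f₁ u * f₂ u = 0 := pow_eq_zero_iff two_ne_zero |>.1 (le_antisymm hCS (sq_nonneg _))
    exact hpos.ne' this
  · have h3 := mul_lt_mul_of_pos_right hlt hGpos
    linarith


end Summit.CriticalPhenomena.Ising3DConformalLimit.LatticeSDPCertificatesWindowForcesU4.BackbonePZProof

end
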